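import Summits.AnomalousDissipation.AnomalousDissipation.Theses.StirringSphere
import Literature.Analysis.FluidPDE.SteadyNavierStokesEnergy
import Literature.Analysis.FluidPDE.StatisticalSolutionDirac

/-!
# Sketch — crux-ideate k=2, round 1, crux `StirringSphere.BoundedSphereStatistics` (stmt-AnomalousDissipation-17145)

First lemmas of the two idea cards of this seat, typed over existing declarations:

* card `dense-directions-calm-windows` (soft-selection envelope):
  `Sig.closedGraph_light` (weak limits in the force DIRECTION at fixed ν of light Foias–Prodi
  statistics are light Foias–Prodi statistics — theorem-grade), `Sig.windowedKB` (windowed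
  Krylov–Bogoliubov: arbitrarily long calm windows of ONE Leray–Hopf flow give a light stationary
  statistical solution — theorem-grade), the transfer target `LightWindowsOnDense` and the PROVED
  compositions `boundedSphereStatistics_of_dense`, `boundedSphereStatistics_of_windows`;
* card `polar-anchor-inertial-sheet`: `Sig.polarSeed_eulerBalanced` (the explicit shear triad
  `U_* = (s₂+s₃, s₃+s₁, s₁+s₂)` is Euler-balanced against the pole force `b₂`: tested steady Euler
  identity — theorem-grade), `Sig.inertialSheet` (the nature-decided heart: a light steady sheet
  over the sphere at every small ν) and the PROVED composition `boundedSphereStatistics_of_sheet`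
  through the tree's Dirac theorem.

No new mathematics is claimed in the proved parts; they are honest logic over the signatures.
-/

set_option linter.dupNamespace false

noncomputable section

namespace Summit.AnomalousDissipation.AnomalousDissipation.Cruxes.BoundedSphereStatistics.SoftSelection

open scoped BigOperators Topology InnerProductSpace
open MeasureTheory Set Filter Function TopologicalSpace
open Literature.Analysis
open Summit.AnomalousDissipation.AnomalousDissipation.Theses.StirringSphere

/-! ### §0 Vocabulary -/

/-- Local abbreviations. -/
abbrev T3 := UnitAddTorus (Fin 3)
abbrev E3 := EuclideanSpace ℝ (Fin 3)
abbrev HH := FunctionSpaces.Torus.energySpace (Fin 3)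

/-- The explicit stirring basis `(b₀, b₁, b₂)` of route StirringSphere (verbatim the route file's
`![…]`): `b₀ = f_GP`, `b₁` = its anti-cyclic cosine partner (`curl b₀ = 2π b₁`), `b₂` the shell-2
field `Σ sin2π(x_j+x_l) e_m`. -/
def stirB : Fin 3 → T3 → E3 :=
  ![(fun x : UnitAddTorus (Fin 3) => (Literature.Analysis.FluidPDE.Torus.stokesMode (Pi.single (2 : Fin 3) (1 : ℤ)) (EuclideanSpace.single (0 : Fin 3) (1 : ℝ)) false x + Literature.Analysis.FluidPDE.Torus.stokesMode (Pi.single (0 : Fin 3) (1 : ℤ)) (EuclideanSpace.single (1 : Fin 3) (1 : ℝ)) false x + Literature.Analysis.FluidPDE.Torus.stokesMode (Pi.single (1 : Fin 3) (1 : ℤ)) (EuclideanSpace.single (2 : Fin 3) (1 : ℝ)) false x : EuclideanSpace ℝ (Fin 3))), (fun x : UnitAddTorus (Fin 3) => (Literature.Analysis.FluidPDE.Torus.stokesMode (Pi.single (1 : Fin 3) (1 : ℤ)) (EuclideanSpace.single (0 : Fin 3) (1 : ℝ)) true x + Literature.Analysis.FluidPDE.Torus.stokesMode (Pi.single (2 :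 Fin 3) (1 : ℤ)) (EuclideanSpace.single (1 : Fin 3) (1 : ℝ)) true x + Literature.Analysis.FluidPDE.Torus.stokesMode (Pi.single (0 : Fin 3) (1 : ℤ)) (EuclideanSpace.single (2 : Fin 3) (1 : ℝ)) true x : EuclideanSpace ℝ (Fin 3))), (fun x : UnitAddTorus (Fin 3) => (Literature.Analysis.FluidPDE.Torus.stokesMode ![(0 : ℤ), 1, 1] (EuclideanSpace.single (0 : Fin 3) (1 : ℝ)) false x + Literature.Analysis.FluidPDE.Torus.stokesMode ![(1 : ℤ), 0, 1] (EuclideanSpace.single (1 : Fin 3) (1 : ℝ)) false x + Literature.Analysis.FluidPDE.Torus.stokesMode ![(1 : ℤ), 1, 0] (EuclideanSpace.single (2 : Fin 3) (1 : ℝ)) false x : EuclideanSpace ℝ (Fin 3)))]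

/-- The force of direction `c`: `f_c = Σᵢ cᵢ bᵢ`. -/
def sphereForce (b : Fin 3 → T3 → E3) (c : E3) : T3 → E3 := fun x => ∑ i : Fin 3, c i • b i x

/-- `LightAt b E ν c`: NS_ν(f_c) admits a Foias–Prodi stationary statistical solution with
integrable mean energy `≤ E` — literally the conclusion of the crux at `(ν, c)`. -/
def LightAt (b : Fin 3 → T3 → E3) (E ν : ℝ) (c : E3) : Prop :=
  ∃ μ : Measure HH, FluidPDE.Torus.IsStationaryStatisticalSolution ν (sphereForce b c) μ ∧
    Integrable (fun u : HH => ‖u‖ ^ 2) μ ∧ FluidPDE.Torus.ensembleEnergy μ ≤ E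

/-- The crux, read through `LightAt` (definitional bookkeeping, proved below). -/
theorem boundedSphereStatistics_iff :
    BoundedSphereStatistics ↔
      ∀ b : Fin 3 → T3 → E3, b = stirB → ∃ E ν₀ : ℝ, 0 < E ∧ 0 < ν₀ ∧
        ∀ c : E3, ‖c‖ = 1 → ∀ ν : ℝ, 0 < ν → ν < ν₀ → LightAt b E ν c :=
  Iff.rfl

/-! ### §1 Card `dense-directions-calm-windows` — signatures -/

/-- **CLOSED GRAPH IN THE FORCE DIRECTION (at fixed ν > 0)** — theorem-grade (FMRT-type
compactness; size L in Lean). If `c_k → c` in `ℝ³` and each NS_ν(f_{c_k}) carries a Foias–Prodi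
statistics of integrable mean energy `≤ E`, then so does NS_ν(f_c), with the SAME `E`.
Print: all SSS live in the FMRT ball `‖u‖ ≤ ‖f_{c_k}‖/(4π²ν)` (tree `ae_norm_le`; `‖f_c‖² = 3/2·‖c‖²`
bounded along the sequence); mean enstrophy `≤ ‖f‖√E/ν` (energy_le) gives tightness in the NORM
topology of `H` by Rellich (`{‖∇u‖ ≤ R} ∩ ball` is norm-compact); along a weakly convergent
subsequence `μ_k ⇀ μ`: the Liouville identity passes to the limit because
`u ↦ nsGeneratorPairing ν f u (Φ.grad u)` is norm-continuous and bounded on the ball and the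
force enters linearly (`f_{c_k} → f_c` uniformly); (1.29) and the shell inequalities (1.31) are
lower semicontinuous in the enstrophy term and continuous in the injection term; `∫‖u‖² dμ ≤
liminf ≤ E` and integrability by Fatou/Portmanteau on the ball. The same lemma is the layer-2
child `ClosedGraphBoundedSSS` foreseen under `HairyBallAlignment` in the route header (one lemma
serves two cruxes). [cite: FMRTTurbulence2001, Ch. IV §1.2 Def. 1.3, §3.1 Prop. 3.1 (K_w compact)] -/
def Sig.closedGraph_light : Prop :=
  ∀ b : Fin 3 → T3 → E3, b = stirB → ∀ (E ν : ℝ), 0 < ν →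
    ∀ (cs : ℕ → E3) (c : E3), Tendsto cs atTop (𝓝 c) → (∀ k, LightAt b E ν (cs k)) → LightAt b E ν c

/-- **WINDOWED KRYLOV–BOGOLIUBOV** — theorem-grade (FMRT IV Prop. 3.1 / Cor. 3.1 / Thm. 3.1 with
the averages taken over sliding windows `[a_k, a_k + L_k]`, `L_k → ∞`, and a generalized limit
along `k`; size M on top of the landed `Theorems.meanEnergy_le_of_ensembleCeiling` chain and the
registered `stub_calmStatistics`). For `ν > 0`, a smooth mean-zero steady force `f`, a global
Leray–Hopf flow `u` from a mean-zero `L²` datum, and a level `E`: if `u` has ARBITRARILY LONG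
E-CALM WINDOWS (for every `L > 0` a window of length `≥ L` with window-mean energy `≤ E`; the
window may sit anywhere, in particular after any transient), then NS_ν(f) has a Foias–Prodi
statistics with integrable mean energy `≤ E`. Boundary terms `(Φ(u(a+L)) − Φ(u(a)))/L → 0`
because `Φ` is bounded on the absorbing ball; the rest is verbatim the `[0,T]` proof. This is
the WEAKEST trajectory statement feeding the crux: every ν-uniformly light compact invariant set
(steady state, periodic orbit, chaotic saddle — stability irrelevant) supplies such windows.
[cite: FMRTTurbulence2001, Ch. IV §3.1 Def. 3.1, Prop. 3.1, Cor. 3.1, Thm. 3.1] -/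
def Sig.windowedKB : Prop :=
  ∀ (ν E : ℝ) (f : T3 → E3) (u₀ : T3 → E3) (u : ℝ → T3 → E3), 0 < ν →
    FunctionSpaces.Torus.IsSmooth f → FunctionSpaces.Torus.HasZeroMean f →
    MemLp u₀ 2 volume → FunctionSpaces.Torus.HasZeroMean u₀ →
    FluidPDE.Torus.IsGlobalLerayHopf ν (fun _ => f) u₀ u →
    (∀ L : ℝ, 0 < L → ∃ a L' : ℝ, 0 ≤ a ∧ L ≤ L' ∧
        (∫ t in a..(a + L'), ∫ x, ‖u t x‖ ^ 2) ≤ E * L') →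
      ∃ μ : Measure HH, FluidPDE.Torus.IsStationaryStatisticalSolution ν f μ ∧
        Integrable (fun v : HH => ‖v‖ ^ 2) μ ∧ FluidPDE.Torus.ensembleEnergy μ ≤ E

/-- **THE TRANSFER TARGET C⁺ = `LightWindowsOnDense`** (open; the ν → 0 content of the crux in
its weakest trajectory form, asked only on a DENSE set of directions). There are `E, ν₀ > 0` and
a set `D` of unit directions, dense in the unit sphere, such that for every `c ∈ D` and every
`ν ∈ (0, ν₀)` SOME global Leray–Hopf flow of NS_ν(f_c) (any mean-zero `L²` datum) has arbitrarily
long E-calm windows. Every nowhere-dense exceptional set is free: the four Beltrami directions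
`±(e₀ ± e₁)/√2` (exact laminar rays — the refuter's kill of `stub_calmRestFlows`), the poles `±e₂`
(exact Euler-balanced seed), the symmetry-enhanced great circles. -/
def LightWindowsOnDense : Prop :=
  ∀ b : Fin 3 → T3 → E3, b = stirB → ∃ (E ν₀ : ℝ) (D : Set E3), 0 < E ∧ 0 < ν₀ ∧
    D ⊆ Metric.sphere (0 : E3) 1 ∧ Metric.sphere (0 : E3) 1 ⊆ closure D ∧
    ∀ c ∈ D, ∀ ν : ℝ, 0 < ν → ν < ν₀ →
      ∃ (u₀ : T3 → E3) (u : ℝ → T3 → E3), MemLp u₀ 2 volume ∧ FunctionSpaces.Torus.HasZeroMean u₀ ∧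
        FluidPDE.Torus.IsGlobalLerayHopf ν (fun _ => sphereForce b c) u₀ u ∧
        ∀ L : ℝ, 0 < L → ∃ a L' : ℝ, 0 ≤ a ∧ L ≤ L' ∧
          (∫ t in a..(a + L'), ∫ x, ‖u t x‖ ^ 2) ≤ E * L'

/-- **LIGHT ON A DENSE SET OF DIRECTIONS** (ensemble form of C⁺; the hypothesis of
`boundedSphereStatistics_of_dense`). -/
def LightOnDense : Prop :=
  ∀ b : Fin 3 → T3 → E3, b = stirB → ∃ (E ν₀ : ℝ) (D : Set E3), 0 < E ∧ 0 < ν₀ ∧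
    D ⊆ Metric.sphere (0 : E3) 1 ∧ Metric.sphere (0 : E3) 1 ⊆ closure D ∧
    ∀ c ∈ D, ∀ ν : ℝ, 0 < ν → ν < ν₀ → LightAt b E ν c

/-- **PER-DIRECTION BOUNDEDNESS** (`Pointwise` of the strategist's census, continuum form): every
unit direction has ITS OWN level and threshold. Genuinely weaker than the crux. -/
def PointwiseLight : Prop :=
  ∀ b : Fin 3 → T3 → E3, b = stirB → ∀ c : E3, ‖c‖ = 1 →
    ∃ E ν₀ : ℝ, 0 < E ∧ 0 < ν₀ ∧ ∀ ν : ℝ, 0 < ν → ν < ν₀ → LightAt b E ν c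

/-- **BAIRE NEEDLE LEMMA** — theorem-grade (size M given `Sig.closedGraph_light`: the sets
`G_n = {c unit : ∀ ν ∈ (0,1/n), LightAt b n ν c}` are CLOSED in the sphere by the closed graph,
increase with `n`, and cover the sphere under `PointwiseLight`; Baire category on the compact
sphere makes `⋃ₙ interior(G_n)` open dense). Conclusion: per-direction boundedness already gives
LOCAL ν-UNIFORMITY on an open dense set `W` of directions; so, granted `PointwiseLight`, the crux
can fail only through a NEEDLE — levels blowing up along `(ν_k, c_k) → (0, c*)` at a point `c*`
of the closed nowhere-dense exceptional set `S² ∖ W` — and by the sphere's symmetries the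
suspects are its structured directions (±c±, ±e₂, the symmetric great circles). -/
def Sig.baireLocalUniformity : Prop :=
  Sig.closedGraph_light → PointwiseLight →
    ∀ b : Fin 3 → T3 → E3, b = stirB → ∃ W : Set E3, IsOpen W ∧
      Metric.sphere (0 : E3) 1 ⊆ closure (W ∩ Metric.sphere (0 : E3) 1) ∧
      ∀ c ∈ W ∩ Metric.sphere (0 : E3) 1, ∃ E ν₀ δ : ℝ, 0 < E ∧ 0 < ν₀ ∧ 0 < δ ∧
        ∀ c' : E3, ‖c'‖ = 1 → dist c' c < δ → ∀ ν : ℝ, 0 < ν → ν < ν₀ → LightAt b E ν c'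

/-! ### §2 Card `dense-directions-calm-windows` — proved compositions -/

/-- **DENSE DIRECTIONS SUFFICE**: `Sig.closedGraph_light → LightOnDense → BoundedSphereStatistics`
(honest logic: approximate a unit `c` by `c_k ∈ D`, take the light statistics at `c_k`, pass to
the limit at fixed `ν` by the closed-graph lemma; the constants `E, ν₀` are untouched). -/
theorem boundedSphereStatistics_of_dense :
    Sig.closedGraph_light → LightOnDense → BoundedSphereStatistics := by
  intro hCG hD b hb
  obtain ⟨E, ν₀, D, hE, hν₀, -, hdense, hlight⟩ := hD b hb
  refine ⟨E, ν₀, hE, hν₀, fun c hc ν hν hνlt => ?_⟩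
  have hcs : c ∈ closure D := hdense (by simpa [Metric.mem_sphere, dist_zero_right] using hc)
  obtain ⟨cs, hcsD, hcs_tendsto⟩ := mem_closure_iff_seq_limit.1 hcs
  exact hCG b hb E ν hν cs c hcs_tendsto (fun k => hlight (cs k) (hcsD k) ν hν hνlt)

/-- **CALM WINDOWS ON DENSE DIRECTIONS SUFFICE**:
`Sig.windowedKB → Sig.closedGraph_light → LightWindowsOnDense → BoundedSphereStatistics`
(windows ⇒ light statistics direction by direction on `D`, then density). The admissibility of
`f_c` (smooth, mean-zero) is the route's support item, proved in `Lines/birth.lean`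
(`sphereForcesAdmissible`); here it is taken from the route decl `SphereForcesAdmissible` as an
explicit hypothesis to keep this sketch import-light. -/
theorem boundedSphereStatistics_of_windows (hA : SphereForcesAdmissible) :
    Sig.windowedKB → Sig.closedGraph_light → LightWindowsOnDense → BoundedSphereStatistics := by
  intro hKB hCG hW
  refine boundedSphereStatistics_of_dense hCG ?_
  intro b hb
  obtain ⟨E, ν₀, D, hE, hν₀, hDS, hdense, hwin⟩ := hW b hb
  refine ⟨E, ν₀, D, hE, hν₀, hDS, hdense, fun c hcD ν hν hνlt => ?_⟩
  obtain ⟨u₀, u, hu₀, hu₀z, hLH, hcalm⟩ := hwin c hcD ν hν hνlt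
  obtain ⟨hs, -, hz⟩ := hA b (by simpa [stirB] using hb) c
  exact hKB ν E (sphereForce b c) u₀ u hν hs hz hu₀ hu₀z hLH hcalm

/-! ### §3 Card `polar-anchor-inertial-sheet` — signatures and composition -/

/-- The polar shear triad `U_* = (sin2πx₂ + sin2πx₃, sin2πx₃ + sin2πx₁, sin2πx₁ + sin2πx₂)`
(klein-pole-quiet-states / polar-euler-seed: `(U_*·∇)U_* = 2π b₂ + ∇(2πΨ)`,
`2πΨ = −Σ_{i<j} cos2πx_i cos2πx_j`), written as a sum of six first-shell Stokes modes
`stokesMode (e_i) (e_j) false = sin(2π x_i) e_j`, `i ≠ j`. -/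
def polarSeed : T3 → E3 := fun x =>
  (FluidPDE.Torus.stokesMode (Pi.single (1 : Fin 3) (1 : ℤ)) (EuclideanSpace.single (0 : Fin 3) (1 : ℝ)) false x +
    FluidPDE.Torus.stokesMode (Pi.single (2 : Fin 3) (1 : ℤ)) (EuclideanSpace.single (0 : Fin 3) (1 : ℝ)) false x +
    FluidPDE.Torus.stokesMode (Pi.single (2 : Fin 3) (1 : ℤ)) (EuclideanSpace.single (1 : Fin 3) (1 : ℝ)) false x +
    FluidPDE.Torus.stokesMode (Pi.single (0 : Fin 3) (1 : ℤ)) (EuclideanSpace.single (1 : Fin 3) (1 : ℝ)) false x +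
    FluidPDE.Torus.stokesMode (Pi.single (0 : Fin 3) (1 : ℤ)) (EuclideanSpace.single (2 : Fin 3) (1 : ℝ)) false x +
    FluidPDE.Torus.stokesMode (Pi.single (1 : Fin 3) (1 : ℤ)) (EuclideanSpace.single (2 : Fin 3) (1 : ℝ)) false x :
    EuclideanSpace ℝ (Fin 3))

/-- **THE POLE IS EULER-BALANCED** (theorem-grade, M: six trigonometric products + one IBP):
`a·U_*`, `2πa² = 1`, is a steady weak solution of FORCED EULER (`ν = 0`) for the pole force
`b₂ = stirB 2`, i.e. `⟨F₀(aU_*), w⟩ = (b₂, w) + ∫ (aU_* ⊗ aU_*) : ∇w = 0` for every smooth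
solenoidal mean-zero `w` — the tree's own predicate `IsSteadyWeakSolution 0 b₂ ·` on the `H`-lift
of `aU_*`. Energy `‖aU_*‖² = 3/(2π)`, work `(b₂, aU_*) = 0`. -/
def Sig.polarSeed_eulerBalanced : Prop :=
  ∀ U : HH, (((U : Lp E3 2 (volume : Measure T3)) : T3 → E3) =ᵐ[volume]
      fun x => (Real.sqrt (1 / (2 * Real.pi))) • polarSeed x) →
    FluidPDE.Torus.IsSteadyWeakSolution 0 (stirB 2) U ∧ ‖U‖ ^ 2 = 3 / (2 * Real.pi)

/-- **THE INERTIAL SHEET** (the nature-decided heart of card 2; open, XL). There are `E, ν₀ > 0`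
such that every unit `c` and every `ν ∈ (0, ν₀)` carry a steady weak solution `u ∈ V` of
NS_ν(f_c) with `‖u‖² ≤ E` — to be produced by CONTINUATION IN THE FORCE DIRECTION `c` AT FROZEN
`ν` from the light polar anchor (the viscous branch of `aU_*` at `c = e₂`, energy `→ 3/(2π)`),
never along the viscosity axis. Literally `Sig.stub_boundedSteadySphere` of `Lines/birth.lean`
(same signature up to bookkeeping), now with an anchor, an axis and a falsifier; by closed graph
in `c` it is enough off any nowhere-dense set, but lightness must persist INTO the Beltrami points
as limits (honest residual). -/
def Sig.inertialSheet : Prop :=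
  ∀ b : Fin 3 → T3 → E3, b = stirB → ∃ E ν₀ : ℝ, 0 < E ∧ 0 < ν₀ ∧
    ∀ c : E3, ‖c‖ = 1 → ∀ ν : ℝ, 0 < ν → ν < ν₀ →
      ∃ u : HH, (u : Lp E3 2 (volume : Measure T3)) ∈ FunctionSpaces.Torus.energySpaceV (Fin 3) ∧
        FluidPDE.Torus.IsSteadyWeakSolution ν (sphereForce b c) u ∧ ‖u‖ ^ 2 ≤ E

/-- **Composition for card 2**: the inertial sheet closes the crux BY NAME through the tree's
Dirac theorem (`isStationaryStatisticalSolution_dirac_holds`: `δ_u` at a steady weak `u ∈ V` is a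
Foias–Prodi statistics; `integrable_dirac`; `integral_dirac'`), exactly as
`BoundedSphereStatistics_of_steady` in `Lines/birth.lean`; `f_c ∈ L²` from the admissibility
support item. -/
theorem boundedSphereStatistics_of_sheet (hA : SphereForcesAdmissible) :
    Sig.inertialSheet → BoundedSphereStatistics := by
  intro h b hb
  obtain ⟨E, ν₀, hE, hν₀, H⟩ := h b hb
  refine ⟨E, ν₀, hE, hν₀, fun c hc ν hν hνlt => ?_⟩
  obtain ⟨u, hV, hsteady, hEu⟩ := H c hc ν hν hνlt
  obtain ⟨hs, -, -⟩ := hA b (by simpa [stirB] using hb) c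
  refine ⟨Measure.dirac u, ?_, FluidPDE.Torus.integrable_dirac u _, ?_⟩
  · exact FluidPDE.Torus.isStationaryStatisticalSolution_dirac_holds hν.le (hs.memLp 2) (by simp) hV hsteady
  · unfold FluidPDE.Torus.ensembleEnergy
    have h := integral_dirac' (fun v : HH => ‖v‖ ^ 2) u ((continuous_norm.pow 2).stronglyMeasurable)
    calc ∫ v : HH, ‖v‖ ^ 2 ∂Measure.dirac u = ‖u‖ ^ 2 := h
      _ ≤ E := hEu

end Summit.AnomalousDissipation.AnomalousDissipation.Cruxes.BoundedSphereStatistics.SoftSelection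

end
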